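import Mathlib
import HarnessLib
import Summits.CriticalPhenomena.Ising3DConformalLimit.Theorems.HyperoctahedralRPTwoPointKernelOfLimitClauses
import Summits.CriticalPhenomena.Ising3DConformalLimit.Theorems.HarmonicMomentsIsotropyTwoPointAsymptoticIsotropyLatticeIntegral
import Summits.CriticalPhenomena.Ising3DConformalLimit.Theorems.HarmonicMomentsIsotropyTwoPointAsymptoticIsotropyBulk
import Literature.Probability.LatticeModels.HighDimPointwiseTriviality
import Literature.Probability.LatticeModels.CriticalScalingDimension
import Summits.CriticalPhenomena.Ising3DConformalLimit.Theorems.HarmonicMomentsIsotropyTwoPointAsymptoticIsotropyShells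

/-!
# Vague asymptotic isotropy of the critical `ℤ³` two-point function from a scale-covariant limit, IV:
# the lattice mass, its dyadic decomposition, geometric decay towards the origin, and `δ³ρ(δ)² → 0`
(route HarmonicMomentsIsotropy, support item stmt-CriticalPhenomena-6036 `TwoPointAsymptoticIsotropy`;
helper file 4/6 of the conditional line `ExistsScaleCovariantLimit → TwoPointAsymptoticIsotropy`)

* `mass(r) = Σ_{‖x‖≤r} ⟨σ₀σ_x⟩_{β_c}` (written with the local notation `ballInd[r]`) satisfies
  `mass(L) = mass(L/2) + Σ_{L/2<‖x‖≤L}` (`mass_eq_mass_half_add_shellSum`);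
* `mass_dyadic_le` — GEOMETRIC DECAY: if beyond the scale `L₀` every inner dyadic shell carries at
  most `2/3` of the mass of the next outer one (the shell ratio of file III), then
  `mass(L/2^J) ≤ mass(L₀) + 3(2/3)^J Σ_{L/2<‖x‖≤L} ⟨σ₀σ_x⟩` for `L ≥ L₀` and all `J` (induction over
  the dyadic range of `L`): the two-point mass near the origin is `O((2/3)^J)` of the mass of the top
  shell, uniformly in `L`;
* `tendsto_cube_mul_rho_sq`: `δ³ρ(δ)² → 0`, from the Simon–Lieb lower bound
  `⟨σ₀σ_x⟩_{β_c} ≥ c‖x‖⁻²` (`criticalTwoPoint_bounds_holds`, Duminil-Copin 2019, Thm. 4.8) at the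
  site `[e₀/δ]`, where `ρ(δ)²⟨σ₀σ_{[e₀/δ]}⟩ → K(e₀)`; this disposes of the finitely many sites of the
  core `‖x‖ ≤ L₀`.

References: H. Duminil-Copin, *Lectures on the Ising and Potts models* (2019), Thm. 4.8;
H. Duminil-Copin, ICM 2022, §8.1. No definitions are introduced.
-/

noncomputable section

namespace Summit.CriticalPhenomena.Ising3DConformalLimit.HarmonicMomentsIsotropyTwoPoint

open Literature.Probability.LatticeModels MeasureTheory Filter Set Metric
open scoped Topology
open Summit.CriticalPhenomena.Ising3DConformalLimit.HyperoctahedralRPTwoPoint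

local notation "E3" => EuclideanSpace ℝ (Fin 3)

/-- The indicator of the spherical shell `{a < ‖y‖ ≤ b}`. -/
local notation3 (prettyPrint := false) "shell[" a "," b "]" =>
  Set.indicator {y : EuclideanSpace ℝ (Fin 3) | a < ‖y‖ ∧ ‖y‖ ≤ b} (fun _ => (1:ℝ))

/-- The indicator of the closed ball `{‖y‖ ≤ r}`. -/
local notation3 (prettyPrint := false) "ballInd[" r "]" =>
  Set.indicator {y : EuclideanSpace ℝ (Fin 3) | ‖y‖ ≤ r} (fun _ => (1:ℝ))

variable {ρ : ℝ → ℝ} {Δ : ℝ} {S : CorrFamily 3}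

/-! ### The lattice mass function and its dyadic decomposition -/

/-- Summability of a lattice function vanishing outside a Euclidean ball. [folklore] -/
theorem summable_of_norm_bound {f : Site 3 → ℝ} {M : ℝ} (h : ∀ x, M < ‖siteVec x‖ → f x = 0) :
    Summable f := by
  refine summable_of_box (N := ⌈M / 1⌉₊) fun x hx => h x ?_
  by_contra hle
  have hle' : ‖(1:ℝ) • siteVec x‖ ≤ M := by rw [one_smul]; exact not_lt.1 hle
  exact absurd (supNorm_le_ceil_of_norm_smul_le one_pos hle') (not_le.2 hx)

/-- The ball indicator is nonnegative. [folklore] -/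
theorem ballInd_nonneg (r : ℝ) (y : E3) : 0 ≤ ballInd[r] y :=
  Set.indicator_nonneg (fun _ _ => zero_le_one) _

/-- The ball indicator is monotone in the radius. [folklore] -/
theorem ballInd_mono {r r' : ℝ} (h : r ≤ r') (y : E3) : ballInd[r] y ≤ ballInd[r'] y :=
  Set.indicator_le_indicator_of_subset (fun _ hz => le_trans hz h) (fun _ => zero_le_one) y

/-- The lattice mass `Σ_{‖x‖ ≤ r} ⟨σ₀σ_x⟩_{β_c}` is summable (a finite sum). [folklore] -/
theorem summable_mass (r : ℝ) :
    Summable fun x : Site 3 => ballInd[r] (siteVec x) * criticalTwoPoint 3 x :=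
  summable_of_norm_bound (M := r) fun x hx => by
    rw [indicator_of_notMem (show siteVec x ∉ {y : E3 | ‖y‖ ≤ r} from fun h => absurd h (not_le.2 hx)),
      zero_mul]

/-- The lattice mass is monotone in the radius. [folklore] -/
theorem mass_mono {r r' : ℝ} (h : r ≤ r') :
    ∑' x : Site 3, ballInd[r] (siteVec x) * criticalTwoPoint 3 x ≤
      ∑' x : Site 3, ballInd[r'] (siteVec x) * criticalTwoPoint 3 x :=
  (summable_mass r).tsum_le_tsum (fun x => mul_le_mul_of_nonneg_right (ballInd_mono h _)
    (criticalTwoPoint_nonneg' x)) (summable_mass r')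

/-- The lattice mass is nonnegative. [folklore] -/
theorem mass_nonneg (r : ℝ) :
    0 ≤ ∑' x : Site 3, ballInd[r] (siteVec x) * criticalTwoPoint 3 x :=
  tsum_nonneg fun x => mul_nonneg (ballInd_nonneg _ _) (criticalTwoPoint_nonneg' x)

/-- Pointwise dyadic decomposition: `1_{‖v‖≤L} = 1_{‖v‖≤L/2} + shell[1/2,1](L⁻¹ v)` (`L > 0`).
[folklore] -/
theorem ballInd_eq_add_shell {L : ℝ} (hL : 0 < L) (v : E3) :
    ballInd[L] v = ballInd[L / 2] v + shell[1 / 2, 1] (L⁻¹ • v) := by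
  have hn : ‖L⁻¹ • v‖ = L⁻¹ * ‖v‖ := by
    rw [norm_smul, Real.norm_eq_abs, abs_of_pos (inv_pos.2 hL)]
  have hiff1 : 1 / 2 < L⁻¹ * ‖v‖ ↔ L / 2 < ‖v‖ := by
    rw [← div_eq_inv_mul, lt_div_iff₀ hL]
    constructor <;> intro h <;> linarith
  have hiff2 : L⁻¹ * ‖v‖ ≤ 1 ↔ ‖v‖ ≤ L := by
    rw [← div_eq_inv_mul, div_le_one hL]
  simp only [Set.indicator_apply, mem_setOf_eq, hn, hiff1, hiff2]
  by_cases h1 : ‖v‖ ≤ L / 2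
  · have h2 : ‖v‖ ≤ L := h1.trans (by linarith)
    have h3 : ¬ (L / 2 < ‖v‖) := not_lt.2 h1
    simp [h1, h2, h3]
  · by_cases h2 : ‖v‖ ≤ L
    · simp [h1, h2, not_le.1 h1]
    · simp [h1, h2]

/-- Dyadic decomposition of the lattice mass: `mass(L) = mass(L/2) + Σ_{L/2<‖x‖≤L}` (`L > 0`).
[folklore] -/
theorem mass_eq_mass_half_add_shellSum {L : ℝ} (hL : 0 < L) :
    ∑' x : Site 3, ballInd[L] (siteVec x) * criticalTwoPoint 3 x =
      ∑' x : Site 3, ballInd[L / 2] (siteVec x) * criticalTwoPoint 3 x +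
        ∑' x : Site 3, shell[1 / 2, 1] (L⁻¹ • siteVec x) * criticalTwoPoint 3 x := by
  have hsum : Summable fun x : Site 3 => shell[1 / 2, 1] (L⁻¹ • siteVec x) * criticalTwoPoint 3 x :=
    summable_of_norm_bound (M := L) fun x hx => by
      rw [shell_eq_zero_of_gt, zero_mul]
      rw [norm_smul, Real.norm_eq_abs, abs_of_pos (inv_pos.2 hL), ← div_eq_inv_mul,
        lt_div_iff₀ hL, one_mul]
      exact hx
  rw [← (summable_mass _).tsum_add hsum]
  refine tsum_congr fun x => ?_
  rw [ballInd_eq_add_shell hL, add_mul]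

/-- **Geometric decay of the lattice mass towards the origin.** If beyond the scale `L₀ > 0` every
inner dyadic shell carries at most `2/3` of the mass of the next outer one, then for `L ≥ L₀` and
every `J`, `mass(L/2^J) ≤ mass(L₀) + 3 (2/3)^J Σ_{L/2<‖x‖≤L} ⟨σ₀σ_x⟩_{β_c}`. [folklore] -/
theorem mass_dyadic_le {L₀ : ℝ} (hL₀ : 0 < L₀)
    (hratio : ∀ L, L₀ ≤ L →
      ∑' x : Site 3, shell[1 / 2, 1] ((L / 2)⁻¹ • siteVec x) * criticalTwoPoint 3 x ≤
        2 / 3 * ∑' x : Site 3, shell[1 / 2, 1] (L⁻¹ • siteVec x) * criticalTwoPoint 3 x)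
    {L : ℝ} (hL : L₀ ≤ L) (J : ℕ) :
    ∑' x : Site 3, ballInd[L / 2 ^ J] (siteVec x) * criticalTwoPoint 3 x ≤
      ∑' x : Site 3, ballInd[L₀] (siteVec x) * criticalTwoPoint 3 x +
        3 * (2 / 3) ^ J * ∑' x : Site 3, shell[1 / 2, 1] (L⁻¹ • siteVec x) * criticalTwoPoint 3 x := by
  -- abbreviations
  set mass : ℝ → ℝ := fun r => ∑' x : Site 3, ballInd[r] (siteVec x) * criticalTwoPoint 3 x
    with hmass
  set D : ℝ → ℝ := fun L => ∑' x : Site 3, shell[1 / 2, 1] (L⁻¹ • siteVec x) * criticalTwoPoint 3 x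
    with hD
  have hD0 : ∀ L, 0 ≤ D L := fun L => shellSum_nonneg _ _ _
  have hdec : ∀ L, 0 < L → mass L = mass (L / 2) + D L := fun L hL =>
    mass_eq_mass_half_add_shellSum hL
  have hmono : ∀ r r', r ≤ r' → mass r ≤ mass r' := fun r r' h => mass_mono h
  have hratio' : ∀ L, L₀ ≤ L → D (L / 2) ≤ 2 / 3 * D L := fun L hL => hratio L hL
  show mass (L / 2 ^ J) ≤ mass L₀ + 3 * (2 / 3) ^ J * D L
  -- the claim, by induction on the dyadic range of `L`
  suffices key : ∀ n : ℕ, ∀ L, L₀ ≤ L → L < 2 ^ (n + 1) * L₀ → ∀ J : ℕ,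
      mass (L / 2 ^ J) ≤ mass L₀ + 3 * (2 / 3) ^ J * D L by
    obtain ⟨n, hn⟩ := pow_unbounded_of_one_lt (L / L₀) (one_lt_two (α := ℝ))
    have hn' : L < 2 ^ (n + 1) * L₀ := by
      rw [div_lt_iff₀ hL₀] at hn
      calc L < 2 ^ n * L₀ := hn
        _ ≤ 2 ^ (n + 1) * L₀ :=
          mul_le_mul_of_nonneg_right (pow_le_pow_right₀ one_le_two (Nat.le_succ n)) hL₀.le
    exact key n L hL hn' J
  intro n
  induction n with
  | zero =>
    intro L hL hL2 J
    rw [zero_add, pow_one] at hL2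
    have hLpos : 0 < L := hL₀.trans_le hL
    have hhalf : mass (L / 2) ≤ mass L₀ := hmono _ _ (by linarith)
    rcases Nat.eq_zero_or_pos J with hJ | hJ
    · subst hJ
      rw [pow_zero, div_one, pow_zero, mul_one, hdec L hLpos]
      linarith [hD0 L]
    · have hJ2 : L / 2 ^ J ≤ L / 2 := by
        refine div_le_div_of_nonneg_left hLpos.le two_pos ?_
        calc (2:ℝ) = 2 ^ 1 := (pow_one 2).symm
          _ ≤ 2 ^ J := pow_le_pow_right₀ one_le_two hJ
      calc mass (L / 2 ^ J) ≤ mass (L / 2) := hmono _ _ hJ2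
        _ ≤ mass L₀ := hhalf
        _ ≤ mass L₀ + 3 * (2 / 3) ^ J * D L := by
          have := hD0 L; nlinarith [pow_pos (by norm_num : (0:ℝ) < 2 / 3) J]
  | succ n ih =>
    intro L hL hL2 J
    by_cases hsmall : L < 2 ^ (n + 1) * L₀
    · exact ih L hL hsmall J
    · have hbig : 2 ^ (n + 1) * L₀ ≤ L := not_lt.1 hsmall
      have hLpos : 0 < L := hL₀.trans_le hL
      have h2L₀ : L₀ ≤ L / 2 := by
        rw [le_div_iff₀ two_pos]
        calc L₀ * 2 = 2 ^ 1 * L₀ := by ring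
          _ ≤ 2 ^ (n + 1) * L₀ :=
            mul_le_mul_of_nonneg_right (pow_le_pow_right₀ one_le_two (by omega)) hL₀.le
          _ ≤ L := hbig
      have hL2' : L / 2 < 2 ^ (n + 1) * L₀ := by
        rw [div_lt_iff₀ two_pos]
        have : (2:ℝ) ^ (n + 1 + 1) * L₀ = 2 ^ (n + 1) * L₀ * 2 := by rw [pow_succ]; ring
        linarith
      have ih' := ih (L / 2) h2L₀ hL2'
      have hr := hratio' L hL
      rcases Nat.eq_zero_or_pos J with hJ | hJ
      · subst hJ
        rw [pow_zero, div_one, pow_zero, mul_one, hdec L hLpos]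
        have h0 := ih' 0
        rw [pow_zero, div_one, pow_zero, mul_one] at h0
        linarith [hD0 L]
      · obtain ⟨J', rfl⟩ : ∃ J', J = J' + 1 := ⟨J - 1, by omega⟩
        have h1 := ih' J'
        have hdiv : L / 2 / 2 ^ J' = L / 2 ^ (J' + 1) := by rw [pow_succ]; ring
        rw [hdiv] at h1
        calc mass (L / 2 ^ (J' + 1)) ≤ mass L₀ + 3 * (2 / 3) ^ J' * D (L / 2) := h1
          _ ≤ mass L₀ + 3 * (2 / 3) ^ J' * (2 / 3 * D L) := by
            have : 0 ≤ 3 * (2 / 3 : ℝ) ^ J' := by positivity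
            nlinarith
          _ = mass L₀ + 3 * (2 / 3) ^ (J' + 1) * D L := by rw [pow_succ]; ring

/-! ### The renormalisation: `δ³ ρ(δ)² → 0` (from the lower bound `⟨σ₀σ_x⟩_{β_c} ≥ c‖x‖⁻²`) -/

/-- The lattice approximation of the unit vector `e₀` at mesh `δ` is `⌊1/δ⌋ e₀`. [folklore] -/
theorem latticeApprox_single (δ : ℝ) :
    latticeApprox δ (EuclideanSpace.single (0 : Fin 3) (1:ℝ)) = Pi.single (0 : Fin 3) ⌊1 / δ⌋ := by
  funext i
  simp only [latticeApprox_apply, EuclideanSpace.single, PiLp.single_apply]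
  by_cases hi : i = 0
  · subst hi; simp
  · rw [if_neg hi, Pi.single_eq_of_ne hi, zero_div, Int.floor_zero]

/-- **`δ³ ρ(δ)² → 0` as `δ → 0⁺`.** At the site `[e₀/δ] = ⌊1/δ⌋e₀` the lower bound
`⟨σ₀σ_x⟩_{β_c} ≥ c‖x‖_∞⁻²` (Simon–Lieb, `criticalTwoPoint_bounds_holds`) gives
`ρ(δ)² c δ² ≤ ρ(δ)² ⟨σ₀σ_{[e₀/δ]}⟩ → K(e₀)`, so `δ³ρ(δ)² = O(δ)`.
[cite: DuminilCopin2019, Thm. 4.8, §4.4] -/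
theorem tendsto_cube_mul_rho_sq (hlim : HasPointwiseScalingLimit (criticalCorr 3) ρ S) :
    Tendsto (fun δ : ℝ => δ ^ 3 * ρ δ ^ 2) (𝓝[>] (0:ℝ)) (𝓝 0) := by
  obtain ⟨c, C, hc, hbd⟩ := criticalTwoPoint_bounds_holds (d := 3) le_rfl
  set e : E3 := EuclideanSpace.single (0 : Fin 3) (1:ℝ) with he
  have he0 : e ≠ 0 := by
    intro h
    have := congrArg (fun v : E3 => v 0) h
    simp [he] at this
  set κ : ℝ := S 2 ![0, e] + 1 with hκ
  have hconv := tendsto_rescaled_twoPoint hlim he0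
  have hev1 : ∀ᶠ δ in 𝓝[>] (0:ℝ), ρ δ ^ 2 * criticalTwoPoint 3 (latticeApprox δ e) < κ :=
    (tendsto_order.1 hconv).2 _ (by rw [hκ]; linarith)
  have hδ1 : ∀ᶠ δ in 𝓝[>] (0:ℝ), δ < 1 :=
    (eventually_lt_nhds one_pos).filter_mono nhdsWithin_le_nhds
  have hup : ∀ᶠ δ in 𝓝[>] (0:ℝ), δ ^ 3 * ρ δ ^ 2 ≤ κ / c * δ := by
    filter_upwards [hev1, hδ1, self_mem_nhdsWithin] with δ h1 h2 hδpos
    have hδ : 0 < δ := hδpos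
    set b : Site 3 := latticeApprox δ e with hb
    have hb' : b = Pi.single (0 : Fin 3) ⌊1 / δ⌋ := by rw [hb, he, latticeApprox_single]
    have hfloor1 : (1:ℤ) ≤ ⌊1 / δ⌋ := by
      rw [Int.le_floor, Int.cast_one, le_div_iff₀ hδ, one_mul]; exact h2.le
    have hfloorpos : (0:ℝ) < (⌊1 / δ⌋ : ℝ) := by exact_mod_cast hfloor1
    have hnorm : ‖b‖ = (⌊1 / δ⌋ : ℝ) := by
      rw [hb', norm_single_axis, abs_of_pos hfloorpos]
    have hb0 : b ≠ 0 := by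
      intro h0
      rw [h0, norm_zero] at hnorm
      linarith
    have hnorm_le : ‖b‖ ≤ 1 / δ := by rw [hnorm]; exact Int.floor_le _
    have hnorm_pos : 0 < ‖b‖ := by rw [hnorm]; exact hfloorpos
    -- the lower bound at `b`
    have hlow := (hbd b hb0).1
    have hrpow : (1 / δ) ^ (-((3:ℝ) - 1)) ≤ ‖b‖ ^ (-((3:ℝ) - 1)) :=
      Real.rpow_le_rpow_of_nonpos hnorm_pos hnorm_le (by norm_num)
    have hδ2 : (1 / δ) ^ (-((3:ℝ) - 1)) = δ ^ 2 := by
      rw [show (-((3:ℝ) - 1)) = -(2:ℝ) by norm_num, Real.rpow_neg (by positivity), one_div,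
        Real.inv_rpow hδ.le, inv_inv, show (2:ℝ) = ((2:ℕ):ℝ) by norm_num, Real.rpow_natCast]
    have hG : c * δ ^ 2 ≤ criticalTwoPoint 3 b := by
      calc c * δ ^ 2 = c * (1 / δ) ^ (-((3:ℝ) - 1)) := by rw [hδ2]
        _ ≤ c * ‖b‖ ^ (-((3:ℝ) - 1)) := mul_le_mul_of_nonneg_left hrpow hc.le
        _ ≤ criticalTwoPoint 3 b := by exact_mod_cast hlow
    have hρ2 : 0 ≤ ρ δ ^ 2 := sq_nonneg _
    have hkey : ρ δ ^ 2 * (c * δ ^ 2) < κ := (mul_le_mul_of_nonneg_left hG hρ2).trans_lt h1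
    rw [div_mul_eq_mul_div, le_div_iff₀ hc]
    nlinarith
  have hlow : ∀ᶠ δ in 𝓝[>] (0:ℝ), 0 ≤ δ ^ 3 * ρ δ ^ 2 := by
    filter_upwards [self_mem_nhdsWithin] with δ hδ
    exact mul_nonneg (pow_nonneg (le_of_lt hδ) 3) (sq_nonneg _)
  have hlin : Tendsto (fun δ : ℝ => κ / c * δ) (𝓝[>] (0:ℝ)) (𝓝 0) := by
    have h : Tendsto (fun δ : ℝ => κ / c * δ) (𝓝 (0:ℝ)) (𝓝 (κ / c * 0)) :=
      tendsto_id.const_mul _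
    rw [mul_zero] at h
    exact h.mono_left nhdsWithin_le_nhds
  exact tendsto_of_tendsto_of_tendsto_of_le_of_le' tendsto_const_nhds hlin hlow hup

end Summit.CriticalPhenomena.Ising3DConformalLimit.HarmonicMomentsIsotropyTwoPoint

end
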